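import Literature.NumberTheory.EllipticCurves.IwasawaAlgebraCharIdealPrimePowerTorsionProofs
import Literature.NumberTheory.EllipticCurves.IwasawaAlgebraPseudoNullPrimePairProofs
import HarnessLib

/-!
# Two ideals that contain each other up to a height-two pair and a prime power have characteristic ideals that agree up to powers of that prime:
# `(f₁, g₁)·I_A ⊆ I_B`, `ϖ^k·(f₂, g₂)·I_B ⊆ I_A` ⟹ `∃ i i′, char(R/I_B)·(ϖ)^i = char(R/I_A)·(ϖ)^{i′}` — the algebraic skeleton of the
# «closure comparison up to (2)-powers» of de Shalit III §1.4 / Lemma 1.10 (brick §4(c) at `p = 2`, item D4χ), for any Noetherian domain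

Generic commutative algebra (everything PROVED, nothing assumed), composing two tree results of the same family: the HEIGHT-TWO PAIR criterion
(`Module.charIdeal_quotient_eq_of_prime_pair_smul_le`: `f·A ⊆ B`, `g·A ⊆ B`, `f` prime, `f ∤ g` ⟹ `char(N/B) = char(N/(A ⊔ B))`) and the PRIME-POWER
slack (`Module.exists_charIdeal_quotient_mul_span_pow_eq_of_smul_le`: `A′ ≤ A`, `ϖ^k·A ⊆ A′` ⟹ `∃ i i′, char(N/A′)·(ϖ)^i = char(N/A)·(ϖ)^{i′}`), both for
finitely generated torsion quotients.  Here `N = R` and `A`, `B` are ideals; the zero ideal (non-torsion quotient) is handled separately: under the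
hypotheses `I_A = 0 ⟺ I_B = 0`.

* `Module.isTorsion_quotient_of_ne_bot` — `R/I` is a torsion `R`-module for `I ≠ 0` (`R` a domain);
* ★★ `Module.exists_charIdeal_quotient_mul_span_pow_eq_of_two_sided_sandwich` — THE SKELETON: for ideals `I_A`, `I_B` of a Noetherian domain `R`, prime
  elements `ϖ`, `f₁`, `f₂` and elements `g₁`, `g₂` with `f₁ ∤ g₁`, `f₂ ∤ g₂`, if `f₁·I_A ⊆ I_B`, `g₁·I_A ⊆ I_B` and `ϖ^k f₂·I_B ⊆ I_A`, `ϖ^k g₂·I_B ⊆ I_A`,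
  then **`∃ i i′, char(R/I_B)·(ϖ)^i = char(R/I_A)·(ϖ)^{i′}`**.  Proof: `char(R/I_B) = char(R/(I_A ⊔ I_B))` (pair `f₁, g₁`);
  `char(R/(I_A ⊔ (ϖ^k)·I_B))·(ϖ)^i = char(R/(I_A ⊔ I_B))·(ϖ)^{i′}` (slack, `ϖ^k·(I_A ⊔ I_B) ⊆ I_A ⊔ (ϖ^k)·I_B`); `char(R/I_A) = char(R/((ϖ^k)·I_B ⊔ I_A))`
  (pair `f₂, g₂`).
* `Module.exists_charIdeal_quotient_mul_span_pow_eq_of_le_of_smul_le` — the special case `I_A ⊆ I_B` (no first pair needed).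

USE (cell `bsd-print-cf2`, width seat `bsd-line-cf2c-w7` g26, brick §4(c) at `p = 2`, item D4χ `BrickCD4Chi.BrickCD4ChiClosureComparison` of
`Cruxes/TwoVariableMainConjAtSplitTwoQuad/BRICK-C-D4-g25.md`): in the Coleman lane BOTH sides of the item are `char_Λ(Λ ⧸ φ_ε(Col_Σ C))`
(`ColemanCoinvariantTrace.charIdeal_coinvariants_colemanImageTrace_eq`), `Λ = 𝒪_v⟦X⟧⟦T⟧`, `ϖ = 2` (prime since `K_v = ℚ₂`); with `I_A = φ_ε(Col_Σ A_χ)`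
(averaged theta units) and `I_B = φ_ε(Col_Σ B_χ)` (Shapiro image of Rubin's closure) the first pair is the augmentation pair of D4a/D4b
(`(σ̃_𝔞 − N𝔞)·A ⊆ B`, de Shalit II §4.12) and the second is D4c/(γ)/(2)-slack.  `--supports` crux stmt-BirchSwinnertonDyer-24033.  BSD is not advanced by
this file.

References: E. de Shalit, *Iwasawa theory of elliptic curves with complex multiplication* (1987), II §4.12 (29)–(32), III §1.4 (5), Cor. 1.5 (7),
Lemma 1.10 (17); N. Bourbaki, *Algèbre commutative* VII §4 no. 5 Prop. 10–11; J. Neukirch, A. Schmidt, K. Wingberg, *Cohomology of Number Fields*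
(2nd ed.) Ch. V §1 (5.1.4)–(5.1.6), §3 (5.3.9)–(5.3.10).
-/

noncomputable section

namespace Literature.NumberTheory.EllipticCurves

namespace Module

variable {R : Type*} [CommRing R] [IsNoetherianRing R] [IsDomain R]

/-! ### Torsion quotients by non-zero ideals -/

omit [IsNoetherianRing R] in
/-- `R ⧸ I` is a torsion `R`-module when `I ≠ 0` (`R` a domain): a non-zero `y ∈ I` kills every class. [cite: BourbakiAC5to7, Ch. VII §4 no. 5] -/
theorem isTorsion_quotient_of_ne_bot {I : Ideal R} (hI : I ≠ ⊥) : Module.IsTorsion R (R ⧸ I) := by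
  obtain ⟨y, hyI, hy0⟩ := I.ne_bot_iff.mp hI
  intro x
  obtain ⟨z, rfl⟩ := Ideal.Quotient.mk_surjective x
  refine ⟨⟨y, mem_nonZeroDivisors_of_ne_zero hy0⟩, ?_⟩
  rw [Submonoid.smul_def, Algebra.smul_def, Ideal.Quotient.algebraMap_eq, ← map_mul, Ideal.Quotient.eq_zero_iff_mem]
  exact I.mul_mem_right z hyI

omit [IsNoetherianRing R] in
/-- If `c·I_B ⊆ I_A` with `c ≠ 0` and `I_A = 0`, then `I_B = 0`. [cite: BourbakiAC5to7, Ch. VII §4 no. 5] -/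
theorem eq_bot_of_smul_le_bot {I_A I_B : Ideal R} {c : R} (hc : c ≠ 0) (h : ∀ b ∈ I_B, c • b ∈ I_A) (hA : I_A = ⊥) : I_B = ⊥ := by
  rw [Submodule.eq_bot_iff]
  intro b hb
  have hcb : c • b ∈ (⊥ : Ideal R) := hA ▸ h b hb
  rw [Submodule.mem_bot, smul_eq_mul, mul_eq_zero] at hcb
  exact hcb.resolve_left hc

omit [IsNoetherianRing R] [IsDomain R] in
/-- Elements of `(ϖ^k)·I` are `ϖ^k·b`, `b ∈ I`. [cite: BourbakiAC5to7, Ch. VII §4 no. 5] -/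
private theorem exists_eq_pow_mul_of_mem_span_mul {ϖ : R} {k : ℕ} {I : Ideal R} {a : R} (ha : a ∈ Ideal.span {ϖ ^ k} * I) :
    ∃ b ∈ I, a = ϖ ^ k * b := by
  obtain ⟨b, hb, rfl⟩ := Ideal.mem_span_singleton_mul.mp ha
  exact ⟨b, hb, rfl⟩

/-! ### The two-sided sandwich -/

/-- ★★ **THE TWO-SIDED SANDWICH.**  `R` a Noetherian domain, `ϖ`, `f₁`, `f₂` prime elements, `f₁ ∤ g₁`, `f₂ ∤ g₂`; ideals `I_A`, `I_B` with
`f₁·I_A ⊆ I_B`, `g₁·I_A ⊆ I_B` (a height-two pair puts `I_A` inside `I_B`) and `ϖ^k f₂·I_B ⊆ I_A`, `ϖ^k g₂·I_B ⊆ I_A` (a height-two pair and a power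
of `ϖ` put `I_B` inside `I_A`).  Then **`∃ i i′, char(R ⧸ I_B)·(ϖ)^i = char(R ⧸ I_A)·(ϖ)^{i′}`**. [cite: deShalit1987, III §1.4 (5), Lemma 1.10 (17)]
[cite: BourbakiAC5to7, Ch. VII §4 no. 5 Prop. 10–11] [cite: NeukirchSchmidtWingberg2008, Ch. V §3 (5.3.9)–(5.3.10)] -/
theorem exists_charIdeal_quotient_mul_span_pow_eq_of_two_sided_sandwich (I_A I_B : Ideal R) {ϖ f₁ g₁ f₂ g₂ : R} (k : ℕ)
    (hϖ : Prime ϖ) (hf₁ : Prime f₁) (hfg₁ : ¬ f₁ ∣ g₁) (hf₂ : Prime f₂) (hfg₂ : ¬ f₂ ∣ g₂)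
    (h₁f : ∀ a ∈ I_A, f₁ • a ∈ I_B) (h₁g : ∀ a ∈ I_A, g₁ • a ∈ I_B)
    (h₂f : ∀ b ∈ I_B, (ϖ ^ k * f₂) • b ∈ I_A) (h₂g : ∀ b ∈ I_B, (ϖ ^ k * g₂) • b ∈ I_A) :
    ∃ i i' : ℕ, charIdeal R (R ⧸ I_B) * Ideal.span {ϖ} ^ i = charIdeal R (R ⧸ I_A) * Ideal.span {ϖ} ^ i' := by
  by_cases hA : I_A = ⊥
  · -- then `I_B = ⊥` too
    have hB : I_B = ⊥ := eq_bot_of_smul_le_bot (mul_ne_zero (pow_ne_zero k hϖ.ne_zero) hf₂.ne_zero) h₂f hA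
    subst hA; subst hB
    exact ⟨0, 0, rfl⟩
  · -- `I_A ≠ 0`, hence `I_B ≠ 0`; all quotients below are finitely generated torsion
    have hB : I_B ≠ ⊥ := by
      obtain ⟨a, haI, ha0⟩ := I_A.ne_bot_iff.mp hA
      exact I_B.ne_bot_iff.mpr ⟨f₁ • a, h₁f a haI, by rw [smul_eq_mul]; exact mul_ne_zero hf₁.ne_zero ha0⟩
    have htB : Module.IsTorsion R (R ⧸ I_B) := isTorsion_quotient_of_ne_bot hB
    have htA : Module.IsTorsion R (R ⧸ I_A) := isTorsion_quotient_of_ne_bot hA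
    -- (1) `char(R/I_B) = char(R/(I_A ⊔ I_B))`
    have h1 : charIdeal R (R ⧸ I_B) = charIdeal R (R ⧸ (I_A ⊔ I_B)) :=
      charIdeal_quotient_eq_of_prime_pair_smul_le I_A I_B htB hf₁ hfg₁ h₁f h₁g
    -- (2) slack between `A′ := I_A ⊔ (ϖ^k)·I_B` and `A := I_A ⊔ I_B`
    set A' : Ideal R := I_A ⊔ Ideal.span {ϖ ^ k} * I_B with hA'def
    have hle : A' ≤ I_A ⊔ I_B := sup_le le_sup_left (Ideal.mul_le_left.trans le_sup_right)
    have hA'ne : A' ≠ ⊥ := fun h ↦ hA (le_bot_iff.mp (le_sup_left.trans h.le))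
    haveI : Module.Finite R (R ⧸ A') := inferInstance
    have htA' : Module.IsTorsion R (R ⧸ A') := isTorsion_quotient_of_ne_bot hA'ne
    have hsm : ∀ a ∈ I_A ⊔ I_B, ϖ ^ k • a ∈ A' := by
      intro a ha
      obtain ⟨x, hx, y, hy, rfl⟩ := Submodule.mem_sup.mp ha
      rw [smul_add]
      exact Submodule.add_mem _ (Submodule.mem_sup_left (I_A.smul_mem _ hx))
        (Submodule.mem_sup_right (Ideal.mem_span_singleton_mul.mpr ⟨y, hy, rfl⟩))
    obtain ⟨i, i', h2⟩ := exists_charIdeal_quotient_mul_span_pow_eq_of_smul_le A' (I_A ⊔ I_B) hle htA' hϖ hsm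
    -- (3) `char(R/I_A) = char(R/((ϖ^k)·I_B ⊔ I_A)) = char(R/A′)`
    have h3 : charIdeal R (R ⧸ I_A) = charIdeal R (R ⧸ A') := by
      rw [hA'def, sup_comm]
      refine charIdeal_quotient_eq_of_prime_pair_smul_le (Ideal.span {ϖ ^ k} * I_B) I_A htA hf₂ hfg₂ ?_ ?_
      · intro a ha
        obtain ⟨b, hb, rfl⟩ := exists_eq_pow_mul_of_mem_span_mul ha
        have e : f₂ • (ϖ ^ k * b) = (ϖ ^ k * f₂) • b := by simp only [smul_eq_mul]; ring
        rw [e]; exact h₂f b hb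
      · intro a ha
        obtain ⟨b, hb, rfl⟩ := exists_eq_pow_mul_of_mem_span_mul ha
        have e : g₂ • (ϖ ^ k * b) = (ϖ ^ k * g₂) • b := by simp only [smul_eq_mul]; ring
        rw [e]; exact h₂g b hb
    exact ⟨i', i, by rw [h1, ← h2, ← h3]⟩

/-- **One-sided case `I_A ⊆ I_B`**: if moreover `ϖ^k f₂·I_B ⊆ I_A`, `ϖ^k g₂·I_B ⊆ I_A` for a prime `f₂ ∤ g₂`, then
`∃ i i′, char(R ⧸ I_B)·(ϖ)^i = char(R ⧸ I_A)·(ϖ)^{i′}` (apply the slack to `I_A ⊔ (ϖ^k)·I_B ≤ I_B` and the pair to `(ϖ^k)·I_B` over `I_A`).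
[cite: deShalit1987, III §1.4 (5), Lemma 1.10 (17)] [cite: BourbakiAC5to7, Ch. VII §4 no. 5 Prop. 10–11] -/
theorem exists_charIdeal_quotient_mul_span_pow_eq_of_le_of_smul_le (I_A I_B : Ideal R) (hAB : I_A ≤ I_B) {ϖ f₂ g₂ : R} (k : ℕ)
    (hϖ : Prime ϖ) (hf₂ : Prime f₂) (hfg₂ : ¬ f₂ ∣ g₂)
    (h₂f : ∀ b ∈ I_B, (ϖ ^ k * f₂) • b ∈ I_A) (h₂g : ∀ b ∈ I_B, (ϖ ^ k * g₂) • b ∈ I_A) :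
    ∃ i i' : ℕ, charIdeal R (R ⧸ I_B) * Ideal.span {ϖ} ^ i = charIdeal R (R ⧸ I_A) * Ideal.span {ϖ} ^ i' :=
  exists_charIdeal_quotient_mul_span_pow_eq_of_two_sided_sandwich I_A I_B k hϖ hf₂ hfg₂ hf₂ hfg₂
    (fun _ ha ↦ hAB (I_A.smul_mem _ ha)) (fun _ ha ↦ hAB (I_A.smul_mem _ ha)) h₂f h₂g

end Module

end Literature.NumberTheory.EllipticCurves

end
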